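import Mathlib
import Summits.AtomisticToContinuum.Crystallization.Theorems.ChessboardParticlePlanesLjLaminarWindowsSparseAllSpikyB
import Summits.AtomisticToContinuum.Crystallization.Theorems.ChessboardParticlePlanesLjLaminarWindowsSparseAllSpikyC
import Summits.AtomisticToContinuum.Crystallization.Theorems.ChessboardParticlePlanesLjLaminarWindowsPathCount
import HarnessLib

/-! # All-spiky neighbourhoods are impossible in the sparse regime — stub `stub_sparseAllSpiky` of line
`Sketch` (skeleton rev. 14a, lead c8), crux `LjLaminarWindows` (stmt-AtomisticToContinuum-6711)

Stage B of the non-spiky-fraction argument.  Given the thick-circle count `hTC`, Bonferroni `hBonf`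
and the triple thick-sphere lemma `hTT`: for `θ ∈ (0,1)`, `R ≥ 1`, `M₁ > 0` and `L ≥ L₂`, no particle
`a` of a `7/10`-separated `23/20`-connected configuration can have all particles within `L` spiky at
scale `L`, at most `M₁ L` particles within `2L`, and a particle beyond `2L`.  Proof: `m = O(M₁/θ)`
ring points `q_i` within `L/10` of `a` (connectivity) have shells holding `≥ σ₀ = θ · 20L/23`
particles each (path count); the heavy region (particles within `2 r₁`, `r₁ = c_r L`, of a particle
with `≥ c₂ L` neighbours within `2r₁`) serves these shells with total weight `≤ 344 M₁ L` (few heavy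
centres `sparse_heavy_card`, small blobs `sparse_sum_blobs`, Bonferroni inside each blob
`sparse_heavy_service` with the local thick-circle bound from `hTC`); the diffuse remainder is light
(`sparse_light`) and the common part of three distinct ring shells lies in two `r₁`-balls (`hTT`), so
`sparse_core` gives the contradiction. -/

noncomputable section

open scoped BigOperators
open Filter Topology
open Literature.MathematicalPhysics.StatisticalMechanics
open Summit.AtomisticToContinuum.Crystallization.Theorems.ChargedEnergyGapNegative

namespace Summit.AtomisticToContinuum.Crystallization.Theorems.LjLaminarWindowsSketch

/-- Constants of Stage B: given `θ ∈ (0,1)`, `R ≥ 1`, `M₁` there are `m ≥ 2` with `m θ ≥ 800 M₁`,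
`K = 10(2m+1)`, `c₂ = θ/(6m³) > 0`, `Am = 4·10⁴ R² (K+1) > 0` and `cr = c₂/(125 m² Am) ∈ (0, 1/100]`.
[folklore] -/
theorem sparse_constants {θ R : ℝ} (M₁ : ℝ) (hθ : 0 < θ) (hθ1 : θ < 1) (hR : 1 ≤ R) :
    ∃ (m : ℕ) (K c₂ Am cr : ℝ), (2 : ℝ) ≤ m ∧ 800 * M₁ ≤ (m : ℝ) * θ ∧ K = 10 * (2 * m + 1) ∧
      c₂ = θ / (6 * (m : ℝ) ^ 3) ∧ 0 < c₂ ∧ Am = 40000 * R ^ 2 * (K + 1) ∧ 0 < Am ∧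
      cr = c₂ / (125 * (m : ℝ) ^ 2 * Am) ∧ 0 < cr ∧ cr ≤ 1 / 100 := by
  obtain ⟨m, hm⟩ : ∃ m : ℕ, m = ⌈800 * M₁ / θ⌉₊ + 2 := ⟨_, rfl⟩
  have hmθ : 800 * M₁ ≤ (m : ℝ) * θ := by
    have h1 : 800 * M₁ / θ ≤ ⌈800 * M₁ / θ⌉₊ := Nat.le_ceil _
    have h2 : (⌈800 * M₁ / θ⌉₊ : ℝ) ≤ m := by rw [hm]; push_cast; linarith
    have h3 : 800 * M₁ / θ * θ = 800 * M₁ := by field_simp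
    nlinarith
  have hm2 : (2 : ℝ) ≤ m := by
    rw [hm]; push_cast; linarith [Nat.cast_nonneg (α := ℝ) ⌈800 * M₁ / θ⌉₊]
  have hm1 : (1 : ℝ) ≤ m := by linarith
  have hm3 : (1 : ℝ) ≤ (m : ℝ) ^ 3 := one_le_pow₀ hm1
  have hmsq : (1 : ℝ) ≤ (m : ℝ) ^ 2 := one_le_pow₀ hm1
  have hK1 : (1 : ℝ) ≤ 10 * (2 * m + 1) := by linarith
  have hAm1 : (40000 : ℝ) ≤ 40000 * R ^ 2 * (10 * (2 * m + 1) + 1) := by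
    have : (1 : ℝ) ≤ R ^ 2 * (10 * (2 * m + 1) + 1) := by nlinarith
    nlinarith
  have hc₂0 : 0 < θ / (6 * (m : ℝ) ^ 3) := by positivity
  have hc₂1 : θ / (6 * (m : ℝ) ^ 3) ≤ 1 := by
    rw [div_le_one (by positivity)]
    nlinarith
  refine ⟨m, 10 * (2 * m + 1), θ / (6 * (m : ℝ) ^ 3), 40000 * R ^ 2 * (10 * (2 * m + 1) + 1),
    θ / (6 * (m : ℝ) ^ 3) / (125 * (m : ℝ) ^ 2 * (40000 * R ^ 2 * (10 * (2 * m + 1) + 1))),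
    hm2, hmθ, rfl, rfl, hc₂0, rfl, by linarith, rfl, by positivity, ?_⟩
  rw [div_le_iff₀ (by positivity)]
  nlinarith

/-- **Stage B — an all-spiky neighbourhood is impossible in the sparse regime** (registered stub
`stub_sparseAllSpiky` of line `Sketch`, from the thick-circle count `hTC`, Bonferroni `hBonf` and the
triple thick-sphere lemma `hTT`). [folklore] -/
theorem stub_sparseAllSpiky
    (hTC : ∀ (N : ℕ) (x : Fin N → E3), (∀ j k : Fin N, j ≠ k → (7 : ℝ) / 10 ≤ dist (x j) (x k)) →
      ∀ (L R : ℝ), 1 ≤ R → 100 * R ≤ L →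
      ∀ (q q' z : E3) (r : ℝ), 4 * R ≤ dist q q' → dist q q' ≤ L / 2 → 0 ≤ r →
        ((Finset.univ.filter fun j : Fin N =>
            (L - R < dist (x j) q ∧ dist (x j) q ≤ L) ∧ (L - R < dist (x j) q' ∧ dist (x j) q' ≤ L) ∧
              dist (x j) z ≤ r).card : ℝ) ≤
          10000 * (r + Real.sqrt (L * R)) * R ^ 2 * (L / dist q q' + 1))
    (hBonf : ∀ (N m : ℕ) (A : ℕ → Finset (Fin N)),
      ∑ i ∈ Finset.range m, ((A i).card : ℝ) ≤
        (((Finset.range m).biUnion A).card : ℝ) +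
          ∑ i ∈ Finset.range m, ∑ j ∈ Finset.range i, ((A i ∩ A j).card : ℝ))
    (hTT :
      ∀ (cr K : ℝ), 0 < cr → 1 ≤ K → ∃ L₃ : ℝ, ∀ (L R D : ℝ), 1 ≤ R → L₃ * R ≤ L → L ≤ K * D →
      ∀ (a b c : E3), D ≤ dist a b → D ≤ dist a c → D ≤ dist b c →
        dist a b ≤ L / 5 → dist a c ≤ L / 5 → dist b c ≤ L / 5 →
        ∃ y₁ y₂ : E3, ∀ y : E3,
          L - R < dist y a → dist y a ≤ L → L - R < dist y b → dist y b ≤ L →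
          L - R < dist y c → dist y c ≤ L →
          dist y y₁ ≤ cr * L ∨ dist y y₂ ≤ cr * L) :
    ∀ θ R M₁ : ℝ, 0 < θ → θ < 1 → 1 ≤ R → 0 < M₁ → ∃ L₂ : ℝ, ∀ L : ℝ, L₂ ≤ L →
      ∀ (N : ℕ) (x : Fin N → E3),
      (∀ j k : Fin N, j ≠ k → (7 : ℝ) / 10 ≤ dist (x j) (x k)) →
      (∀ S : Finset (Fin N), S.Nonempty → Sᶜ.Nonempty →
          ∃ p ∈ S, ∃ k ∈ Sᶜ, dist (x p) (x k) ≤ 23 / 20) →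
      ∀ a : Fin N,
        (∀ p : Fin N, dist (x p) (x a) ≤ L →
          θ * ((Finset.univ.filter fun q : Fin N => dist (x q) (x p) ≤ L).card : ℝ) <
            ((Finset.univ.filter fun q : Fin N =>
              L - R < dist (x q) (x p) ∧ dist (x q) (x p) ≤ L).card : ℝ)) →
        ((Finset.univ.filter fun j : Fin N => dist (x j) (x a) ≤ 2 * L).card : ℝ) ≤ M₁ * L →
        (∃ j : Fin N, 2 * L < dist (x j) (x a)) → False := by
  intro θ R M₁ hθ hθ1 hR _hM₁
  classical
  obtain ⟨m, K, c₂, Am, cr, hm2, hmθ, hK, hc₂, hc₂0, hAm, hAm0, hcr, hcr0, hcr1⟩ :=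
    sparse_constants M₁ hθ hθ1 hR
  have hm0 : (0 : ℝ) < m := by linarith only [hm2]
  have hK1 : (1 : ℝ) ≤ K := by rw [hK]; linarith only [hm2]
  have hK0 : (0 : ℝ) < K := by linarith only [hK1]
  obtain ⟨L₃, hTT'⟩ := hTT cr K hcr0 hK1
  refine ⟨max (L₃ * R) (max (4 * K * R) (max (100 * R) (R / cr ^ 2 + 1))), ?_⟩
  intro L hL N x hsep hconn a hspiky hmass hfar
  /- bounds on `L` -/
  have hL3 : L₃ * R ≤ L := le_trans (le_max_left _ _) hL
  have hL4K : 4 * K * R ≤ L := le_trans (le_trans (le_max_left _ _) (le_max_right _ _)) hL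
  have hL100 : 100 * R ≤ L :=
    le_trans (le_trans (le_trans (le_max_left _ _) (le_max_right _ _)) (le_max_right _ _)) hL
  have hLcr : R / cr ^ 2 + 1 ≤ L :=
    le_trans (le_trans (le_trans (le_max_right _ _) (le_max_right _ _)) (le_max_right _ _)) hL
  have hL0 : 0 < L := by linarith only [hL100, hR]
  have hx : Function.Injective x := massBound_injective x hsep
  have hsqrt : Real.sqrt (L * R) ≤ cr * L := by
    have h1 : R ≤ cr ^ 2 * L := by
      have h := (div_le_iff₀ (by positivity : (0 : ℝ) < cr ^ 2)).1
        (by linarith only [hLcr] : R / cr ^ 2 ≤ L)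
      linarith only [h]
    calc Real.sqrt (L * R) ≤ Real.sqrt ((cr * L) ^ 2) :=
          Real.sqrt_le_sqrt (by nlinarith only [h1, hL0])
      _ = cr * L := Real.sqrt_sq (by positivity)
  /- the ring spacing `D = L / K` -/
  obtain ⟨D, hD⟩ : ∃ D : ℝ, D = L / K := ⟨_, rfl⟩
  have hKD : K * D = L := by rw [hD]; field_simp
  have hD4 : 4 * R ≤ D := by
    rw [hD, le_div_iff₀ hK0]
    linarith only [hL4K]
  have hD0 : 0 < D := by linarith only [hD4, hR]
  have hD23 : (23 : ℝ) / 20 ≤ D := by linarith only [hD4, hR]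
  have hmD : (2 * (m : ℝ) + 1) * D = L / 10 := by
    have e : (2 * (m : ℝ) + 1) = K / 10 := by rw [hK]; ring
    rw [e, div_mul_eq_mul_div, hKD]
  /- ring points -/
  obtain ⟨jfar, hjfar⟩ := hfar
  obtain ⟨Q, hQ⟩ := massBound_rings x hconn hD23 m a ⟨jfar, by rw [hmD]; linarith only [hjfar, hL0]⟩
  obtain ⟨hQa', hQsep'⟩ := massBound_rings_dist x hD0.le m a Q hQ
  have hQa : ∀ i < m, dist (x (Q i)) (x a) ≤ L / 10 := fun i hi => by rw [← hmD]; exact hQa' i hi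
  have hQpair : ∀ i < m, ∀ j < m, i ≠ j →
      D ≤ dist (x (Q i)) (x (Q j)) ∧ dist (x (Q i)) (x (Q j)) ≤ L / 5 := by
    intro i hi j hj hij
    rcases lt_or_gt_of_ne hij with h | h
    · obtain ⟨h1, h2⟩ := hQsep' j hj i h
      rw [dist_comm] at h1 h2
      rw [hmD] at h2
      exact ⟨h1, by linarith only [h2]⟩
    · obtain ⟨h1, h2⟩ := hQsep' i hi j h
      rw [hmD] at h2
      exact ⟨h1, by linarith only [h2]⟩
  /- shells of the ring points -/
  obtain ⟨SH, hSH⟩ : ∃ SH : ℕ → Finset (Fin N), ∀ i, SH i = Finset.univ.filter fun q : Fin N =>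
      L - R < dist (x q) (x (Q i)) ∧ dist (x q) (x (Q i)) ≤ L := ⟨_, fun _ => rfl⟩
  obtain ⟨σ₀, hσ₀⟩ : ∃ σ₀ : ℝ, σ₀ = θ * (L / (23 / 20)) := ⟨_, rfl⟩
  have hshell : ∀ i < m, σ₀ ≤ ((SH i).card : ℝ) := by
    intro i hi
    have h1 := hspiky (Q i) (by linarith only [hQa i hi, hL0])
    have hfar' : ∃ j : Fin N, L < dist (x j) (x (Q i)) := by
      refine ⟨jfar, ?_⟩
      have h3 := dist_triangle (x jfar) (x (Q i)) (x a)
      linarith only [h3, hQa i hi, hjfar, hL0]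
    have h2 := stub_pathCount N x (23 / 20) (by norm_num) hconn (Q i) L hL0.le hfar'
    rw [hSH i, hσ₀]
    nlinarith only [h1, h2, hθ]
  /- the region `G` -/
  obtain ⟨G, hG⟩ : ∃ G : Finset (Fin N), G = Finset.univ.filter fun j : Fin N =>
      dist (x j) (x a) ≤ 11 / 10 * L := ⟨_, rfl⟩
  have hSHG : ∀ i < m, SH i ⊆ G := by
    intro i hi q hq
    rw [hSH i, Finset.mem_filter] at hq
    rw [hG]
    refine Finset.mem_filter.2 ⟨Finset.mem_univ _, ?_⟩
    have h3 := dist_triangle (x q) (x (Q i)) (x a)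
    linarith only [h3, hQa i hi, hq.2.2]
  have hGa : ∀ j ∈ G, dist (x j) (x a) ≤ 6 / 5 * L := fun j hj => by
    rw [hG] at hj
    linarith only [(Finset.mem_filter.1 hj).2, hL0]
  have hGcard : (G.card : ℝ) ≤ M₁ * L := by
    refine le_trans ?_ hmass
    rw [hG]
    exact_mod_cast Finset.card_le_card (Finset.monotone_filter_right _ fun j _ hj => by
      linarith only [hj, hL0])
  /- heavy particles, blobs, heavy and diffuse regions -/
  obtain ⟨r₁, hr₁⟩ : ∃ r₁ : ℝ, r₁ = cr * L := ⟨_, rfl⟩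
  have hr₁0 : 0 < r₁ := by rw [hr₁]; positivity
  have hr₁L : 100 * r₁ ≤ L := by rw [hr₁]; nlinarith only [hcr1, hL0]
  obtain ⟨Hv, hHv⟩ : ∃ Hv : Finset (Fin N), Hv = Finset.univ.filter fun h : Fin N =>
      c₂ * L ≤ ((Finset.univ.filter fun q : Fin N => dist (x q) (x h) ≤ 2 * r₁).card : ℝ) ∧
        dist (x h) (x a) ≤ 6 / 5 * L := ⟨_, rfl⟩
  obtain ⟨Y, hYHv, hYsep, hYcov⟩ := massBound_cover x Hv hr₁0.le
  have hYa : ∀ y ∈ Y, dist (x y) (x a) ≤ 6 / 5 * L := fun y hy => by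
    have h := hYHv hy
    rw [hHv] at h
    exact (Finset.mem_filter.1 h).2.2
  have hYheavy : ∀ y ∈ Y,
      c₂ * L ≤ ((Finset.univ.filter fun q : Fin N => dist (x q) (x y) ≤ 2 * r₁).card : ℝ) :=
    fun y hy => by
      have h := hYHv hy
      rw [hHv] at h
      exact (Finset.mem_filter.1 h).2.1
  obtain ⟨W, hW⟩ : ∃ W : Fin N → Finset (Fin N), ∀ y, W y = Finset.univ.filter fun j : Fin N =>
      dist (x j) (x y) ≤ 3 * r₁ := ⟨_, fun _ => rfl⟩
  obtain ⟨Xh, hXh⟩ : ∃ Xh : Finset (Fin N), Xh = G.filter fun j =>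
      ∃ h ∈ Hv, dist (x j) (x h) ≤ 2 * r₁ := ⟨_, rfl⟩
  obtain ⟨Xl, hXl⟩ : ∃ Xl : Finset (Fin N), Xl = G.filter fun j =>
      ¬ ∃ h ∈ Hv, dist (x j) (x h) ≤ 2 * r₁ := ⟨_, rfl⟩
  have hXhW : Xh ⊆ Y.biUnion W := by
    intro j hj
    rw [hXh] at hj
    obtain ⟨h, hh, hjh⟩ := (Finset.mem_filter.1 hj).2
    obtain ⟨y, hy, hhy⟩ := hYcov h hh
    refine Finset.mem_biUnion.2 ⟨y, hy, ?_⟩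
    rw [hW y]
    refine Finset.mem_filter.2 ⟨Finset.mem_univ _, ?_⟩
    have h3 := dist_triangle (x j) (x h) (x y)
    linarith only [h3, hjh, hhy]
  have hXlcard : (Xl.card : ℝ) ≤ M₁ * L := by
    refine le_trans ?_ hGcard
    rw [hXl]
    exact_mod_cast Finset.card_le_card (Finset.filter_subset _ _)
  have hlight : ∀ z : E3, ((Xl.filter fun j => dist (x j) z ≤ r₁).card : ℝ) < c₂ * L := by
    refine sparse_light x a G Xl (by positivity) hGa ?_
    intro j hj
    rw [hXl] at hj
    obtain ⟨hjG, hjno⟩ := Finset.mem_filter.1 hj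
    refine ⟨hjG, fun h hheavy hnear hdist => hjno ⟨h, ?_, hdist⟩⟩
    rw [hHv]
    exact Finset.mem_filter.2 ⟨Finset.mem_univ _, hheavy, hnear⟩
  /- (1) few heavy centres, small blobs -/
  have hYcard : (Y.card : ℝ) * (c₂ * L) ≤ 125 * (M₁ * L) :=
    sparse_heavy_card x hx a Y hr₁0 (by linarith only [hr₁L, hr₁0]) hYa hYsep hYheavy hmass
  have hWsum : ∑ y ∈ Y, ((W y).card : ℝ) ≤ 343 * (M₁ * L) := by
    have h := sparse_sum_blobs x hx a Y hr₁0 (by linarith only [hr₁L, hr₁0]) hYa hYsep hmass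
    exact le_of_eq_of_le (Finset.sum_congr rfl fun y _ => by rw [hW y]) h
  /- (2) local thick-circle bound inside a blob -/
  obtain ⟨τ, hτ⟩ : ∃ τ : ℝ, τ = cr * L * Am := ⟨_, rfl⟩
  have hτ0 : 0 ≤ τ := by rw [hτ]; positivity
  have hI : ∀ y ∈ Y, ∀ i < m, ∀ j < i, ((SH i ∩ SH j ∩ W y).card : ℝ) ≤ τ := by
    intro y _ i hi j hj
    have hjm : j < m := hj.trans hi
    obtain ⟨hDij, hij5⟩ := hQpair i hi j hjm (Nat.ne_of_gt hj)
    have h4 : 4 * R ≤ dist (x (Q i)) (x (Q j)) := le_trans hD4 hDij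
    have hdpos : 0 < dist (x (Q i)) (x (Q j)) := lt_of_lt_of_le hD0 hDij
    have h := hTC N x hsep L R hR hL100 (x (Q i)) (x (Q j)) (x y) (3 * r₁) h4
      (by linarith only [hij5, hL0]) (by positivity)
    have hsub : SH i ∩ SH j ∩ W y ⊆ Finset.univ.filter fun q : Fin N =>
        (L - R < dist (x q) (x (Q i)) ∧ dist (x q) (x (Q i)) ≤ L) ∧
          (L - R < dist (x q) (x (Q j)) ∧ dist (x q) (x (Q j)) ≤ L) ∧ dist (x q) (x y) ≤ 3 * r₁ := by
      intro q hq
      rw [Finset.mem_inter, Finset.mem_inter, hSH i, hSH j, hW y] at hq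
      simp only [Finset.mem_filter, Finset.mem_univ, true_and] at hq
      exact Finset.mem_filter.2 ⟨Finset.mem_univ _, hq.1.1, hq.1.2, hq.2⟩
    have hdiv : L / dist (x (Q i)) (x (Q j)) ≤ K := by
      rw [div_le_iff₀ hdpos]
      calc L = K * D := hKD.symm
        _ ≤ K * dist (x (Q i)) (x (Q j)) := mul_le_mul_of_nonneg_left hDij hK0.le
    calc ((SH i ∩ SH j ∩ W y).card : ℝ) ≤ _ := by exact_mod_cast Finset.card_le_card hsub
      _ ≤ 10000 * (3 * r₁ + Real.sqrt (L * R)) * R ^ 2 * (L / dist (x (Q i)) (x (Q j)) + 1) := h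
      _ ≤ 10000 * (4 * (cr * L)) * R ^ 2 * (K + 1) := by
          have h1 : 3 * r₁ + Real.sqrt (L * R) ≤ 4 * (cr * L) := by
            rw [hr₁]; linarith only [hsqrt]
          have h2 : L / dist (x (Q i)) (x (Q j)) + 1 ≤ K + 1 := by linarith only [hdiv]
          have h3 : 0 ≤ 3 * r₁ + Real.sqrt (L * R) := by positivity
          gcongr
      _ = τ := by rw [hτ, hAm]; ring
  /- (3) heavy service -/
  have hheavy : ∑ i ∈ Finset.range m, ((SH i ∩ Xh).card : ℝ) ≤ 344 * (M₁ * L) := by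
    have h := sparse_heavy_service hBonf m SH Y W Xh hτ0 hXhW hI
    have h2 : (Y.card : ℝ) * ((m : ℝ) ^ 2 * τ) ≤ M₁ * L := by
      have e : (Y.card : ℝ) * ((m : ℝ) ^ 2 * τ) = (Y.card : ℝ) * (c₂ * L) / 125 := by
        rw [hτ, hcr]
        field_simp
      rw [e]
      linarith only [hYcard]
    linarith only [h, h2, hWsum]
  /- (4) the split of each shell into heavy and diffuse parts -/
  have hsplit : ∀ i < m, ((SH i).card : ℝ) = ((SH i ∩ Xh).card : ℝ) + ((SH i ∩ Xl).card : ℝ) := by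
    intro i hi
    have e1 : SH i ∩ Xh = (SH i).filter fun j => ∃ h ∈ Hv, dist (x j) (x h) ≤ 2 * r₁ := by
      ext q
      rw [hXh]
      simp only [Finset.mem_inter, Finset.mem_filter]
      constructor
      · rintro ⟨hq, -, hq'⟩
        exact ⟨hq, hq'⟩
      · rintro ⟨hq, hq'⟩
        exact ⟨hq, hSHG i hi hq, hq'⟩
    have e2 : SH i ∩ Xl = (SH i).filter fun j => ¬ ∃ h ∈ Hv, dist (x j) (x h) ≤ 2 * r₁ := by
      ext q
      rw [hXl]
      simp only [Finset.mem_inter, Finset.mem_filter]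
      constructor
      · rintro ⟨hq, -, hq'⟩
        exact ⟨hq, hq'⟩
      · rintro ⟨hq, hq'⟩
        exact ⟨hq, hSHG i hi hq, hq'⟩
    rw [e1, e2]
    exact_mod_cast (Finset.card_filter_add_card_filter_not _).symm
  /- (5) the triple thick-sphere lemma at three distinct ring points -/
  have hTT3 : ∀ i < m, ∀ j < m, ∀ c < m, i ≠ j → i ≠ c → j ≠ c → ∃ y₁ y₂ : E3,
      ∀ q ∈ SH i ∩ SH j ∩ SH c, dist (x q) y₁ ≤ r₁ ∨ dist (x q) y₂ ≤ r₁ := by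
    intro i hi j hj c hc hij hic hjc
    obtain ⟨hD12, h12⟩ := hQpair i hi j hj hij
    obtain ⟨hD1c, h1c⟩ := hQpair i hi c hc hic
    obtain ⟨hD2c, h2c⟩ := hQpair j hj c hc hjc
    obtain ⟨y₁, y₂, hy⟩ := hTT' L R D hR hL3 hKD.symm.le (x (Q i)) (x (Q j)) (x (Q c))
      hD12 hD1c hD2c h12 h1c h2c
    refine ⟨y₁, y₂, fun q hq => ?_⟩
    rw [Finset.mem_inter, Finset.mem_inter, hSH i, hSH j, hSH c] at hq
    simp only [Finset.mem_filter, Finset.mem_univ, true_and] at hq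
    rw [hr₁]
    exact hy (x q) hq.1.1.1 hq.1.1.2 hq.1.2.1 hq.1.2.2 hq.2.1 hq.2.2
  exact sparse_core x hBonf m SH Xh Xl hθ hL0 hm2 hmθ hσ₀ hc₂ hshell hsplit hheavy hXlcard hlight hTT3

end Summit.AtomisticToContinuum.Crystallization.Theorems.LjLaminarWindowsSketch

end
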